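/-
Copyright (c) 2026 the pub-hodgecm-mathlib formalisation cell (harness21).  Prover seat hodgecm-mathlib-K2E1-p10 (g4), Track B «K2-LIT»,
hLiu418 = stmt-HodgeConjecture-24832, road `K2_Liu`, organ F4 (G-gen), road (E) of record (LEAD F0P6-plan (g14) RULING M-158r; F4 lead K2Liu-p27 (g2)
M-158s verdict 2026-09-04T23:03:11Z), brick (E-a0): THE SUBSTITUTION ACTION OF `GL_p` ∕ `U(p)` ON THE POLYNOMIAL RING OF TWO VECTORS AND TWO
COVECTORS, THE FOUR CONTRACTIONS, THEIR INVARIANCE, AND THE BIDEGREE.  2026-09-04.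
-/
import Mathlib.Algebra.MvPolynomial.Eval
import Mathlib.RingTheory.MvPolynomial.WeightedHomogeneous
import Mathlib.LinearAlgebra.Matrix.GeneralLinearGroup.Defs
import Mathlib.LinearAlgebra.UnitaryGroup
import Mathlib.RingTheory.Adjoin.Basic
import Mathlib.Data.Complex.Basic
import HarnessLib

/-!
# Crux `HLiu418`, organ F4 (G-gen), road (E), brick (E-a0): the substitution action of `GL_p` ∕ `U(p)` on `K[x_{ia}, y_{ja}]` (`i, j < 2`, `a < p`),
# the four contractions `c_{ij} = Σ_a x_{ia} y_{ja}`, their invariance, and the bidegree (`Theorems/K2LiuUnitaryPolySubstDefs.lean`)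

Cell `hodgecm-mathlib`, crux item hLiu418 = `stmt-HodgeConjecture-24832`; squad K2 ∕ K2Liu; LEAD F0P6-plan (g14); F4 lead K2Liu-p27 (g2) (M-158s (1), 23:03:11Z:
«(E-a0) `K2LiuUnitaryPolySubstDefs` — the substitution action of `GL_p`∕`U(p)` on `MvPolynomial ((Fin 2 × Fin p) ⊕ (Fin 2 × Fin p)) ℂ` as explicit `AlgHom`s
(no instance), the four contractions, bidegree (def lane, S–M) → K2E1-p10»); road (E) = K2E5-r02 (g6) 22:54:25Z «compact see-saw + FFT + PBW + `K_H`-averaging»,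
STEP 1: in the Fock model `ℂ[x, y ∈ M_{2×p}]` of `(U(2,2), U(p,0))`, `U(p)` acts by `x ↦ xg`, `y ↦ yḡ`, and the first fundamental theorem for `GL_p` gives
`ℂ[x,y]^{U(p)} = ℂ[Σ_a x_{ia} y_{ja}]`.  DEFINITIONS WITH BODIES + theorems; no instance, no notation, no named-fact hypothesis, no `sorry`;
lane `--kind definition --supports stmt-HodgeConjecture-24832 --as helper`.  Generic commutative ring `K` throughout (`ℂ` only for the unitary restriction §5).

WHAT IS HERE (the currency the FFT bricks (E-a1) `K2LiuUnitaryZariskiDensity`, (E-a2) `K2LiuUnitaryFFTContractionsTwo`, (E-a3) and the Fock letters (E-b) speak):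
* §1 the index type `(Fin 2 × Fin p) ⊕ (Fin 2 × Fin p)` (`inl (i,a)` = the vector coordinate `x_{ia}`, `inr (j,a)` = the covector coordinate `y_{ja}`), the
  substitution `substFun g` (`x ↦ x·g`, `y ↦ y·(g⁻¹)ᵀ` — on `U(p)`, `(g⁻¹)ᵀ = ḡ`, print's `y ↦ yḡ`) and **`polySubst g : R →ₐ[K] R := aeval (substFun g)`**,
  with `polySubst_X_inl`, `polySubst_X_inr`;
* §2 the action laws **`polySubst_one`**, **`polySubst_mul`** (`polySubst (h * g) = (polySubst h).comp (polySubst g)` — a RIGHT action, so substitution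
  anti-composes), `polySubst_inv_comp`, `polySubst_comp_inv` (each `polySubst g` is invertible);
* §3 the contractions **`contraction i j = Σ_a X (inl (i,a)) * X (inr (j,a))`** and **`polySubst_contraction : polySubst g (contraction i j) = contraction i j`**
  (`Σ_a g_{ba} (g⁻¹)_{ac} = δ_{bc}`);
* §4 **`IsGLInvariant f := ∀ g, polySubst g f = f`** (a `Prop`, no instance), closure under `+`, `*`, scalars, and **`isGLInvariant_of_mem_adjoin`**: every element of
  `Algebra.adjoin K (range contraction)` is invariant — the trivial half `⊇` of the FFT; the hard half `⊆` (in bidegree `(d,d)`) is (E-a2)∕(E-a3);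
* §5 (`K = ℂ`) **`IsUnitaryInvariant f := ∀ u : U(p), polySubst (Unitary.toUnits u) f = f`** and `IsGLInvariant.isUnitaryInvariant` (the converse is (E-a1),
  the unitarian trick ∕ Zariski density);
* §6 the bidegree weight `bideg` (`x ↦ (1,0)`, `y ↦ (0,1)`), `isWeightedHomogeneous_contraction` (bidegree `(1,1)`), `isWeightedHomogeneous_substFun`
  (`substFun g v` has the bidegree of `v`) and **`isWeightedHomogeneous_polySubst`** (`polySubst g` preserves every bidegree `(d,e)`).
References: [Weyl1939] H. Weyl, *The Classical Groups* (1939; 2nd ed. 1946), Thm. 2.6.A (FFT for `GL_n`, vectors and covectors); [Howe1989Remarks] R. Howe,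
*Remarks on classical invariant theory*, Trans. AMS 313 (1989), §2; [KashiwaraVergne1978] M. Kashiwara, M. Vergne, Invent. Math. 44 (1978), §II
(the `(U(p), 𝔲(2,2))` harmonics in the Fock model).
HONEST LABEL.  Count-neutral helper (definitions + bookkeeping lemmas; no invariant-theory content beyond the trivial inclusion): `HC_CM` is proved only modulo
the 7 printed citations (2 remaining named inputs: hLiu418 = `stmt-HodgeConjecture-24832`, h413 = `stmt-HodgeConjecture-24833`) until rung 0 closes.

## Tree search
Mathlib: `MvPolynomial.aeval`, `aeval_X`, `comp_aeval`, `aeval_unique`∕`MvPolynomial.algHom_ext`, `Matrix.GeneralLinearGroup` (`GL n K = (Matrix n n K)ˣ`),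
`Units.val_mul`, `Matrix.mul_apply`, `Unitary.toUnits`, `Matrix.unitaryGroup`, `MvPolynomial.IsWeightedHomogeneous` (`isWeightedHomogeneous_X`, `_C`, `.mul`,
`.sum`, `.add`), `Algebra.adjoin_induction`.  No `GL`-action on `MvPolynomial`, no FFT, no Capelli, no Schur–Weyl in Mathlib or in the tree (K2E1-p10 (g4) census
`K2/K2E1-p10/g4/CENSUS-Ea-UnitaryFFTContractions.K2E1-p10-g4.md`).  Dedup: `rg "polySubst|substFun|IsGLInvariant|IsUnitaryInvariant|contraction i j"` over
`Theorems/` + `Literature/` — no clash (`contraction` exists only as prose ∕ unrelated local names).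
-/

set_option autoImplicit false
set_option linter.dupNamespace false -- the mandated namespace repeats `HodgeConjecture.HodgeConjecture`

noncomputable section

open MvPolynomial Matrix

namespace Summit.HodgeConjecture.HodgeConjecture.Cruxes.HLiu418.K2LiuUnitaryPolySubstDefs

variable {K : Type*} [CommRing K] {p : ℕ}

/-! ## §1 The substitution `x ↦ x·g`, `y ↦ y·(g⁻¹)ᵀ` as a `K`-algebra endomorphism of `K[x_{ia}, y_{ja}]` -/

/-- **The substituted variables**: `x_{ia} ↦ Σ_b x_{ib} g_{ba}` (`x ↦ x·g`) and `y_{ja} ↦ Σ_b y_{jb} (g⁻¹)_{ab}` (`y ↦ y·(g⁻¹)ᵀ`; for unitary `g` this is print's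
`y ↦ y·ḡ`). [cite: Weyl1939, Thm. 2.6.A] [cite: KashiwaraVergne1978, §II] -/
def substFun (g : GL (Fin p) K) : (Fin 2 × Fin p) ⊕ (Fin 2 × Fin p) → MvPolynomial ((Fin 2 × Fin p) ⊕ (Fin 2 × Fin p)) K
  | Sum.inl (i, a) => ∑ b, X (Sum.inl (i, b)) * C ((g : Matrix (Fin p) (Fin p) K) b a)
  | Sum.inr (j, a) => ∑ b, X (Sum.inr (j, b)) * C (((g⁻¹ : GL (Fin p) K) : Matrix (Fin p) (Fin p) K) a b)

/-- `substFun g` on a vector coordinate. [folklore] -/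
theorem substFun_inl (g : GL (Fin p) K) (i : Fin 2) (a : Fin p) :
    substFun g (Sum.inl (i, a)) = ∑ b, X (Sum.inl (i, b)) * C ((g : Matrix (Fin p) (Fin p) K) b a) := rfl

/-- `substFun g` on a covector coordinate. [folklore] -/
theorem substFun_inr (g : GL (Fin p) K) (j : Fin 2) (a : Fin p) :
    substFun g (Sum.inr (j, a)) = ∑ b, X (Sum.inr (j, b)) * C (((g⁻¹ : GL (Fin p) K) : Matrix (Fin p) (Fin p) K) a b) := rfl

/-- **THE SUBSTITUTION ACTION `σ_g`** of `g ∈ GL_p(K)` on `K[x_{ia}, y_{ja}]`: the `K`-algebra endomorphism substituting `x ↦ x·g`, `y ↦ y·(g⁻¹)ᵀ`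
(an explicit `AlgHom`, NOT an instance). [cite: Weyl1939, Thm. 2.6.A] [cite: Howe1989Remarks, §2] -/
def polySubst (g : GL (Fin p) K) :
    MvPolynomial ((Fin 2 × Fin p) ⊕ (Fin 2 × Fin p)) K →ₐ[K] MvPolynomial ((Fin 2 × Fin p) ⊕ (Fin 2 × Fin p)) K :=
  aeval (substFun g)

/-- `σ_g` on a variable. [folklore] -/
theorem polySubst_X (g : GL (Fin p) K) (v : (Fin 2 × Fin p) ⊕ (Fin 2 × Fin p)) :
    polySubst g (X v) = substFun g v :=
  aeval_X _ v

/-- `σ_g (x_{ia}) = Σ_b x_{ib} g_{ba}`. [folklore] -/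
theorem polySubst_X_inl (g : GL (Fin p) K) (i : Fin 2) (a : Fin p) :
    polySubst g (X (Sum.inl (i, a))) = ∑ b, X (Sum.inl (i, b)) * C ((g : Matrix (Fin p) (Fin p) K) b a) :=
  aeval_X _ _

/-- `σ_g (y_{ja}) = Σ_b y_{jb} (g⁻¹)_{ab}`. [folklore] -/
theorem polySubst_X_inr (g : GL (Fin p) K) (j : Fin 2) (a : Fin p) :
    polySubst g (X (Sum.inr (j, a))) = ∑ b, X (Sum.inr (j, b)) * C (((g⁻¹ : GL (Fin p) K) : Matrix (Fin p) (Fin p) K) a b) :=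
  aeval_X _ _

/-- `σ_g` on constants. [folklore] -/
theorem polySubst_C (g : GL (Fin p) K) (r : K) : polySubst g (C r) = C r :=
  (polySubst g).commutes r

/-! ## §2 Action laws: `σ_1 = id`, `σ_{hg} = σ_h ∘ σ_g` (right action), inverses -/

/-- **`σ_1 = id`.** [folklore] -/
theorem polySubst_one : polySubst (1 : GL (Fin p) K) = AlgHom.id K _ := by
  refine MvPolynomial.algHom_ext fun v => ?_
  rw [polySubst_X, AlgHom.id_apply]
  rcases v with ⟨i, a⟩ | ⟨j, a⟩
  · rw [substFun_inl, Finset.sum_eq_single a]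
    · rw [Units.val_one, Matrix.one_apply_eq, C_1, mul_one]
    · intro b _ hb
      rw [Units.val_one, Matrix.one_apply_ne hb, C_0, mul_zero]
    · intro h; exact absurd (Finset.mem_univ a) h
  · rw [substFun_inr, inv_one, Finset.sum_eq_single a]
    · rw [Units.val_one, Matrix.one_apply_eq, C_1, mul_one]
    · intro b _ hb
      rw [Units.val_one, Matrix.one_apply_ne (Ne.symm hb), C_0, mul_zero]
    · intro h; exact absurd (Finset.mem_univ a) h

/-- **`σ_{h·g} = σ_h ∘ σ_g`** — the substitution of a RIGHT action anti-composes: `(f·g)·h = f·(gh)` reads `σ_h (σ_g f) = σ_{hg} f`?? no: `σ_g` substitutes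
`x ↦ x·g`, so `σ_h (σ_g x) = (x·h)·g`-pattern gives `x ↦ x·(h g)`; precisely `polySubst (h * g) = (polySubst h).comp (polySubst g)`. [folklore] -/
theorem polySubst_mul (g h : GL (Fin p) K) : polySubst (h * g) = (polySubst h).comp (polySubst g) := by
  refine MvPolynomial.algHom_ext fun v => ?_
  rw [AlgHom.comp_apply, polySubst_X, polySubst_X]
  rcases v with ⟨i, a⟩ | ⟨j, a⟩
  · -- `x_{ia} ↦ Σ_c x_{ic} (hg)_{ca}` versus `σ_h (Σ_b x_{ib} g_{ba}) = Σ_b (Σ_c x_{ic} h_{cb}) g_{ba}`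
    rw [substFun_inl, substFun_inl, map_sum]
    simp_rw [map_mul, polySubst_C, polySubst_X_inl, Finset.sum_mul, mul_assoc, ← C_mul]
    rw [Finset.sum_comm]
    refine Finset.sum_congr rfl fun c _ => ?_
    rw [← Finset.mul_sum, ← map_sum, Units.val_mul, Matrix.mul_apply]
  · -- `y_{ja} ↦ Σ_c y_{jc} ((hg)⁻¹)_{ac}`, `(hg)⁻¹ = g⁻¹ h⁻¹`
    rw [substFun_inr, substFun_inr, map_sum]
    simp_rw [map_mul, polySubst_C, polySubst_X_inr, Finset.sum_mul, mul_assoc, ← C_mul]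
    rw [Finset.sum_comm]
    refine Finset.sum_congr rfl fun c _ => ?_
    rw [← Finset.mul_sum, ← map_sum, _root_.mul_inv_rev, Units.val_mul, Matrix.mul_apply]
    congr 2
    exact Finset.sum_congr rfl fun b _ => mul_comm _ _

/-- `σ_{g⁻¹} ∘ σ_g = id`. [folklore] -/
theorem polySubst_inv_comp (g : GL (Fin p) K) : (polySubst g⁻¹).comp (polySubst g) = AlgHom.id K _ := by
  rw [← polySubst_mul, inv_mul_cancel, polySubst_one]

/-- `σ_g ∘ σ_{g⁻¹} = id`. [folklore] -/
theorem polySubst_comp_inv (g : GL (Fin p) K) : (polySubst g).comp (polySubst g⁻¹) = AlgHom.id K _ := by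
  rw [← polySubst_mul, mul_inv_cancel, polySubst_one]

/-- `σ_g` is injective (it has the left inverse `σ_{g⁻¹}`). [folklore] -/
theorem polySubst_injective (g : GL (Fin p) K) : Function.Injective (polySubst g) := fun f₁ f₂ h => by
  have := congrArg (polySubst g⁻¹) h
  rwa [← AlgHom.comp_apply, ← AlgHom.comp_apply, polySubst_inv_comp, AlgHom.id_apply, AlgHom.id_apply] at this

/-! ## §3 The four contractions and their invariance -/

/-- **The contraction `c_{ij} = Σ_a x_{ia} y_{ja}`** (`i, j < 2`), the pairing of the `i`-th vector with the `j`-th covector.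
[cite: Weyl1939, Thm. 2.6.A] [cite: KashiwaraVergne1978, §II] -/
def contraction (i j : Fin 2) : MvPolynomial ((Fin 2 × Fin p) ⊕ (Fin 2 × Fin p)) K :=
  ∑ a, X (Sum.inl (i, a)) * X (Sum.inr (j, a))

/-- unfolding of `contraction`. [folklore] -/
theorem contraction_def (i j : Fin 2) :
    (contraction i j : MvPolynomial ((Fin 2 × Fin p) ⊕ (Fin 2 × Fin p)) K) = ∑ a, X (Sum.inl (i, a)) * X (Sum.inr (j, a)) := rfl

/-- **THE CONTRACTIONS ARE `GL_p`-INVARIANT**: `σ_g (c_{ij}) = c_{ij}` — `Σ_a (Σ_b x_{ib} g_{ba})(Σ_c y_{jc} (g⁻¹)_{ac}) = Σ_{b,c} x_{ib} y_{jc} (g g⁻¹)_{bc} = c_{ij}`.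
[cite: Weyl1939, Thm. 2.6.A] [cite: Howe1989Remarks, §2] -/
theorem polySubst_contraction (g : GL (Fin p) K) (i j : Fin 2) :
    polySubst g (contraction i j) = contraction i j := by
  rw [contraction_def, map_sum]
  simp_rw [map_mul, polySubst_X_inl, polySubst_X_inr, Finset.sum_mul, Finset.mul_sum]
  -- `Σ_a Σ_b Σ_c x_{ib} g_{ba} (y_{jc} (g⁻¹)_{ac})` → reorder to `Σ_b Σ_c x_{ib} y_{jc} Σ_a g_{ba} (g⁻¹)_{ac}`
  rw [Finset.sum_comm]
  refine Finset.sum_congr rfl fun b _ => ?_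
  rw [Finset.sum_comm]
  have hg : ∀ c : Fin p, ∑ a, (g : Matrix (Fin p) (Fin p) K) b a * ((g⁻¹ : GL (Fin p) K) : Matrix (Fin p) (Fin p) K) a c =
      if b = c then 1 else 0 := fun c => by
    rw [← Matrix.mul_apply, ← Units.val_mul, mul_inv_cancel, Units.val_one, Matrix.one_apply]
  calc ∑ c, ∑ a, X (Sum.inl (i, b)) * C ((g : Matrix (Fin p) (Fin p) K) b a) *
          (X (Sum.inr (j, c)) * C (((g⁻¹ : GL (Fin p) K) : Matrix (Fin p) (Fin p) K) a c))
      = ∑ c, X (Sum.inl (i, b)) * X (Sum.inr (j, c)) * C (∑ a, (g : Matrix (Fin p) (Fin p) K) b a *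
          ((g⁻¹ : GL (Fin p) K) : Matrix (Fin p) (Fin p) K) a c) := by
        refine Finset.sum_congr rfl fun c _ => ?_
        rw [map_sum, Finset.mul_sum]
        refine Finset.sum_congr rfl fun a _ => ?_
        rw [C_mul]; ring
    _ = X (Sum.inl (i, b)) * X (Sum.inr (j, b)) := by
        simp_rw [hg]
        rw [Finset.sum_eq_single b]
        · rw [if_pos rfl, C_1, mul_one]
        · intro c _ hc
          rw [if_neg (Ne.symm hc), C_0, mul_zero]
        · intro h; exact absurd (Finset.mem_univ b) h

/-! ## §4 `GL_p`-invariance as a `Prop`; the trivial half of the first fundamental theorem -/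

/-- **`f` is `GL_p(K)`-invariant**: `σ_g f = f` for every `g`. (A `Prop`, not an instance.) [cite: Weyl1939, Thm. 2.6.A] -/
def IsGLInvariant (f : MvPolynomial ((Fin 2 × Fin p) ⊕ (Fin 2 × Fin p)) K) : Prop :=
  ∀ g : GL (Fin p) K, polySubst g f = f

/-- the contractions are invariant. [cite: Weyl1939, Thm. 2.6.A] -/
theorem isGLInvariant_contraction (i j : Fin 2) : IsGLInvariant (contraction i j : MvPolynomial ((Fin 2 × Fin p) ⊕ (Fin 2 × Fin p)) K) :=
  fun g => polySubst_contraction g i j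

/-- constants are invariant. [folklore] -/
theorem isGLInvariant_C (r : K) : IsGLInvariant (C r : MvPolynomial ((Fin 2 × Fin p) ⊕ (Fin 2 × Fin p)) K) :=
  fun g => polySubst_C g r

/-- invariants are closed under `+`. [folklore] -/
theorem IsGLInvariant.add {f₁ f₂ : MvPolynomial ((Fin 2 × Fin p) ⊕ (Fin 2 × Fin p)) K} (h₁ : IsGLInvariant f₁) (h₂ : IsGLInvariant f₂) :
    IsGLInvariant (f₁ + f₂) := fun g => by
  rw [map_add, h₁ g, h₂ g]

/-- invariants are closed under `*`. [folklore] -/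
theorem IsGLInvariant.mul {f₁ f₂ : MvPolynomial ((Fin 2 × Fin p) ⊕ (Fin 2 × Fin p)) K} (h₁ : IsGLInvariant f₁) (h₂ : IsGLInvariant f₂) :
    IsGLInvariant (f₁ * f₂) := fun g => by
  rw [map_mul, h₁ g, h₂ g]

/-- invariants are closed under scalars. [folklore] -/
theorem IsGLInvariant.smul {f : MvPolynomial ((Fin 2 × Fin p) ⊕ (Fin 2 × Fin p)) K} (h : IsGLInvariant f) (r : K) :
    IsGLInvariant (r • f) := fun g => by
  rw [map_smul, h g]

/-- **THE TRIVIAL HALF OF THE FIRST FUNDAMENTAL THEOREM**: every polynomial in the contractions is `GL_p`-invariant —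
`Algebra.adjoin K {c_{ij}} ⊆ K[x,y]^{GL_p}`.  (The hard half, «invariant of bidegree `(d,d)` ⇒ polynomial in the `c_{ij}`», is (E-a2)∕(E-a3).)
[cite: Weyl1939, Thm. 2.6.A] [cite: Howe1989Remarks, §2] -/
theorem isGLInvariant_of_mem_adjoin {f : MvPolynomial ((Fin 2 × Fin p) ⊕ (Fin 2 × Fin p)) K}
    (hf : f ∈ Algebra.adjoin K (Set.range fun ij : Fin 2 × Fin 2 =>
      (contraction ij.1 ij.2 : MvPolynomial ((Fin 2 × Fin p) ⊕ (Fin 2 × Fin p)) K))) :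
    IsGLInvariant f := by
  refine Algebra.adjoin_induction (fun x hx => ?_) (fun r => ?_) (fun x y _ _ hx hy => hx.add hy) (fun x y _ _ hx hy => hx.mul hy) hf
  · obtain ⟨ij, rfl⟩ := hx
    exact isGLInvariant_contraction ij.1 ij.2
  · intro g
    exact (polySubst g).commutes r

/-! ## §5 `K = ℂ`: invariance under the compact group `U(p)` -/

/-- **`f` is `U(p)`-invariant**: `σ_u f = f` for every unitary `u` (through `Unitary.toUnits : U(p) →* GL_p(ℂ)`; on `U(p)`, `(u⁻¹)ᵀ = ū`, so this is print's
action `x ↦ xu`, `y ↦ yū`). [cite: KashiwaraVergne1978, §II] [cite: Howe1989Remarks, §2] -/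
def IsUnitaryInvariant (f : MvPolynomial ((Fin 2 × Fin p) ⊕ (Fin 2 × Fin p)) ℂ) : Prop :=
  ∀ u : Matrix.unitaryGroup (Fin p) ℂ, polySubst (Unitary.toUnits u) f = f

/-- `GL_p(ℂ)`-invariant ⇒ `U(p)`-invariant (the converse is the unitarian trick, (E-a1)). [cite: Weyl1939, Thm. 2.6.A] -/
theorem IsGLInvariant.isUnitaryInvariant {f : MvPolynomial ((Fin 2 × Fin p) ⊕ (Fin 2 × Fin p)) ℂ} (h : IsGLInvariant f) :
    IsUnitaryInvariant f :=
  fun u => h (Unitary.toUnits u)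

/-- the contractions are `U(p)`-invariant. [cite: KashiwaraVergne1978, §II] -/
theorem isUnitaryInvariant_contraction (i j : Fin 2) :
    IsUnitaryInvariant (contraction i j : MvPolynomial ((Fin 2 × Fin p) ⊕ (Fin 2 × Fin p)) ℂ) :=
  (isGLInvariant_contraction i j).isUnitaryInvariant

/-! ## §6 The bidegree -/

/-- **The bidegree weight**: a vector coordinate `x_{ia}` weighs `(1,0)`, a covector coordinate `y_{ja}` weighs `(0,1)`. [cite: KashiwaraVergne1978, §II] -/
def bideg : (Fin 2 × Fin p) ⊕ (Fin 2 × Fin p) → ℕ × ℕ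
  | Sum.inl _ => (1, 0)
  | Sum.inr _ => (0, 1)

/-- `bideg` on a vector coordinate. [folklore] -/
theorem bideg_inl (ia : Fin 2 × Fin p) : bideg (Sum.inl ia) = (1, 0) := rfl

/-- `bideg` on a covector coordinate. [folklore] -/
theorem bideg_inr (ja : Fin 2 × Fin p) : bideg (Sum.inr ja) = (0, 1) := rfl

/-- **the contractions have bidegree `(1,1)`.** [cite: KashiwaraVergne1978, §II] -/
theorem isWeightedHomogeneous_contraction (i j : Fin 2) :
    IsWeightedHomogeneous (bideg (p := p)) (contraction i j : MvPolynomial ((Fin 2 × Fin p) ⊕ (Fin 2 × Fin p)) K) (1, 1) := by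
  rw [contraction_def]
  refine IsWeightedHomogeneous.sum _ _ _ fun a _ => ?_
  have h := (isWeightedHomogeneous_X K (bideg (p := p)) (Sum.inl (i, a))).mul (isWeightedHomogeneous_X K (bideg (p := p)) (Sum.inr (j, a)))
  rwa [bideg_inl, bideg_inr, Prod.mk_add_mk, add_zero, zero_add] at h

/-- **`substFun g v` has the bidegree of `v`** (each substituted variable is a linear form in variables of the same kind). [folklore] -/
theorem isWeightedHomogeneous_substFun (g : GL (Fin p) K) (v : (Fin 2 × Fin p) ⊕ (Fin 2 × Fin p)) :
    IsWeightedHomogeneous (bideg (p := p)) (substFun g v) (bideg v) := by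
  rcases v with ⟨i, a⟩ | ⟨j, a⟩
  · rw [substFun_inl]
    refine IsWeightedHomogeneous.sum _ _ _ fun b _ => ?_
    have h := (isWeightedHomogeneous_X K (bideg (p := p)) (Sum.inl (i, b))).mul (isWeightedHomogeneous_C (bideg (p := p)) ((g : Matrix (Fin p) (Fin p) K) b a))
    rwa [add_zero] at h
  · rw [substFun_inr]
    refine IsWeightedHomogeneous.sum _ _ _ fun b _ => ?_
    have h := (isWeightedHomogeneous_X K (bideg (p := p)) (Sum.inr (j, b))).mul
      (isWeightedHomogeneous_C (bideg (p := p)) (((g⁻¹ : GL (Fin p) K) : Matrix (Fin p) (Fin p) K) a b))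
    rwa [add_zero] at h

/-- **`σ_g` PRESERVES EVERY BIDEGREE `(d, e)`** (so the bidegree-`(d,e)` statements of (E) STEP 1 are `σ_g`-stable: invariants split by bidegree).
[cite: KashiwaraVergne1978, §II] -/
theorem isWeightedHomogeneous_polySubst (g : GL (Fin p) K) {f : MvPolynomial ((Fin 2 × Fin p) ⊕ (Fin 2 × Fin p)) K} {n : ℕ × ℕ}
    (hf : IsWeightedHomogeneous (bideg (p := p)) f n) :
    IsWeightedHomogeneous (bideg (p := p)) (polySubst g f) n := by
  classical
  -- write `f` as a sum of monomials and substitute monomial by monomial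
  rw [f.as_sum, map_sum]
  refine IsWeightedHomogeneous.sum _ _ _ fun d hd => ?_
  have hdn : Finsupp.weight (bideg (p := p)) d = n := hf (mem_support_iff.1 hd)
  rw [monomial_eq, map_mul, polySubst_C, Finsupp.prod, map_prod, ← hdn]
  -- the product `∏_{v ∈ d.support} (σ_g x_v)^{d v}` is weighted homogeneous of weight `Σ_{v} d v • bideg v = weight bideg d`
  have hprod : IsWeightedHomogeneous (bideg (p := p)) (∏ v ∈ d.support, polySubst g (X v ^ d v)) (∑ v ∈ d.support, d v • bideg v) :=
    IsWeightedHomogeneous.prod d.support _ (fun v => d v • bideg v) fun v _ => by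
      rw [map_pow, polySubst_X]
      exact (isWeightedHomogeneous_substFun g v).pow (d v)
  have hw : (∑ v ∈ d.support, d v • bideg (p := p) v) = Finsupp.weight (bideg (p := p)) d := by
    rw [Finsupp.weight_apply, Finsupp.sum]
  have h := (isWeightedHomogeneous_C (bideg (p := p)) (coeff d f)).mul hprod
  rwa [zero_add, hw] at h

end Summit.HodgeConjecture.HodgeConjecture.Cruxes.HLiu418.K2LiuUnitaryPolySubstDefs

end
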